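import Mathlib
import Summits.Ventures.HodgeRepro.Tier4.Target
import Summits.Ventures.HodgeRepro.Tier4.Line3.KMDatum
import Summits.Ventures.HodgeRepro.Tier4.Line3.KMDatumS
import Summits.Ventures.HodgeRepro.Tier4.Line3.Defs

/-!
# Tier4/Line3/DatumOrthVanishing — every `U(2,1)`-equivariant datum vanishes on the `J`-orthogonal locus

Blind re-derivation cell `pub-hodge-repro`, Tier 4 «PROVE THE STEP», LINE L3, seat t4-x2 (g4, reserve wall-breaker),
cut C-L3-HKRAY (plan-3 g4, bus S14230 / S14274): kernel evidence for finding (F7) of bus S14325.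

For a datum `Φ : KMDatumS` with the equivariance of `ThetaData.equiv` (`Σ_k Φ(M y, M z)_k ∂_l (M z)_k = Φ(y, z)_l` for
every `M ∈ U(2,1)`), the `(1,0)`-form `Φ(y, ·)` VANISHES at every `z ∈ 𝔹` with `(lift3 z)^* J y = 0`: the `J`-reflection
`R = 1 − 2 v v^* J / (v^* J v)` in the hyperplane `v^{⊥_J}`, `v = lift3 z`, lies in `U(2,1)`, fixes `z` (it sends `v` to `−v`)
and fixes `y`, and its Jacobian at `z` is `−1`, so `Φ(y, z) = −Φ(y, z)`.  Consequently the quadruple kernel of any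
`ThetaData` vanishes on the two complex lines `{z : (lift3 z)^* J y_j = 0}` (`j = 0, 1`) through the `J`-orthogonal point
`z*` of a symmetric centre — the Gaussian-free part `P` of the kernel is `0` at `z*`, not positive: the Laplace comparison
behind (HK′) along the ray has interior exponent `k = 2`, not `k = 1`.

Nothing here says anything about the status of the Hodge conjecture for CM abelian varieties, which is NOT proved
(HC_CM is NOT proved by anyone in this repository).
-/

set_option autoImplicit false

noncomputable section

namespace Summit.Ventures.HodgeRepro.Tier4.Line3

open Summit.Ventures.HodgeRepro.Tier4
open Matrix
open scoped ComplexConjugate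

/-! ## 1. The `J`-form in coordinates -/

/-- `J v = (v₀, v₁, −v₂)`. -/
theorem J_mulVec (v : Fin 3 → ℂ) : J *ᵥ v = ![v 0, v 1, -(v 2)] := by
  ext i
  fin_cases i <;> simp [J, Matrix.mulVec_diagonal]

/-- The `J`-form in coordinates: `v^* J u = conj v₀ u₀ + conj v₁ u₁ − conj v₂ u₂`. -/
theorem jform_eq (v u : Fin 3 → ℂ) :
    star v ⬝ᵥ (J *ᵥ u) = conj (v 0) * u 0 + conj (v 1) * u 1 - conj (v 2) * u 2 := by
  simp [J_mulVec, dotProduct, Fin.sum_univ_three]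
  ring

/-- `v^* J v` is real: it equals its own conjugate. -/
theorem conj_jform_self (v : Fin 3 → ℂ) : conj (star v ⬝ᵥ (J *ᵥ v)) = star v ⬝ᵥ (J *ᵥ v) := by
  rw [jform_eq]
  simp only [map_add, map_sub, map_mul, Complex.conj_conj]
  ring

/-- On the ball, `(lift3 z)^* J (lift3 z) = nsq z − 1 ≠ 0`. -/
theorem jform_lift3_self (z : Fin 2 → ℂ) :
    star (lift3 z) ⬝ᵥ (J *ᵥ lift3 z) = ((nsq z - 1 : ℝ) : ℂ) := by
  rw [jform_eq]
  simp only [lift3, nsq, Matrix.cons_val_zero, Matrix.cons_val_one, Matrix.head_cons, Matrix.cons_val_two,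
    Matrix.tail_cons, Complex.ofReal_sub, Complex.ofReal_add, Complex.ofReal_one, map_one, mul_one]
  rw [Complex.conj_mul', Complex.conj_mul']
  push_cast
  ring

/-- `(lift3 z)^* J (lift3 z) ≠ 0` on the ball. -/
theorem jform_lift3_self_ne_zero {z : Fin 2 → ℂ} (hz : z ∈ ball) :
    star (lift3 z) ⬝ᵥ (J *ᵥ lift3 z) ≠ 0 := by
  rw [jform_lift3_self]
  have h : nsq z - 1 ≠ 0 := by
    have hz' : nsq z < 1 := hz
    linarith
  exact_mod_cast h

/-- `cstar` for the complex conjugation is the conjugate transpose. -/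
theorem cstar_starRingAut_eq (A : Matrix (Fin 3) (Fin 3) ℂ) : cstar (starRingAut : ℂ ≃+* ℂ) A = Aᴴ := by
  ext i j
  simp [cstar, Matrix.conjTranspose_apply]

/-- `J` is hermitian. -/
theorem J_conjTranspose : Jᴴ = J := by
  rw [J, Matrix.diagonal_conjTranspose]
  congr 1
  ext i
  fin_cases i <;> simp

/-- `(J v)^* = v^* J`. -/
theorem star_J_mulVec (v : Fin 3 → ℂ) : star (J *ᵥ v) = star v ᵥ* J := by
  rw [Matrix.star_mulVec, J_conjTranspose]

/-- `(J v)^* u = v^* J u`. -/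
theorem star_J_mulVec_dotProduct (v u : Fin 3 → ℂ) : star (J *ᵥ v) ⬝ᵥ u = star v ⬝ᵥ (J *ᵥ u) := by
  rw [star_J_mulVec, Matrix.dotProduct_mulVec]

/-! ## 2. The `J`-reflection in the hyperplane `v^{⊥_J}` -/

/-- The `J`-reflection `R_v = 1 − (2/(v^* J v)) · v (Jv)^*` in the `J`-orthogonal hyperplane of `v`: `R_v v = −v`,
`R_v u = u` for `v^* J u = 0`, `R_v ∈ U(2,1)`. -/
def jReflection (v : Fin 3 → ℂ) : Matrix (Fin 3) (Fin 3) ℂ :=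
  1 - (2 / (star v ⬝ᵥ (J *ᵥ v))) • vecMulVec v (star (J *ᵥ v))

/-- The entries of the reflection. -/
theorem jReflection_apply (v : Fin 3 → ℂ) (i j : Fin 3) :
    jReflection v i j = (if i = j then 1 else 0) - 2 / (star v ⬝ᵥ (J *ᵥ v)) * (v i * conj ((J *ᵥ v) j)) := by
  simp [jReflection, Matrix.one_apply, vecMulVec_apply]

/-- `R_v u = u − (2 (v^* J u)/(v^* J v)) v`. -/
theorem jReflection_mulVec (v u : Fin 3 → ℂ) :
    jReflection v *ᵥ u = u - (2 / (star v ⬝ᵥ (J *ᵥ v)) * (star v ⬝ᵥ (J *ᵥ u))) • v := by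
  rw [jReflection, Matrix.sub_mulVec, Matrix.one_mulVec, Matrix.smul_mulVec, vecMulVec_mulVec, op_smul_eq_smul,
    star_J_mulVec_dotProduct, smul_smul]

/-- `R_v v = −v` (when `v^* J v ≠ 0`). -/
theorem jReflection_mulVec_self {v : Fin 3 → ℂ} (hv : star v ⬝ᵥ (J *ᵥ v) ≠ 0) : jReflection v *ᵥ v = -v := by
  rw [jReflection_mulVec, div_mul_cancel₀ _ hv]
  ext i
  simp only [Pi.sub_apply, Pi.smul_apply, smul_eq_mul, Pi.neg_apply]
  ring

/-- `R_v u = u` for `u ⊥_J v`. -/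
theorem jReflection_mulVec_of_jOrth (v : Fin 3 → ℂ) {u : Fin 3 → ℂ} (hu : star v ⬝ᵥ (J *ᵥ u) = 0) :
    jReflection v *ᵥ u = u := by
  rw [jReflection_mulVec, hu, mul_zero, zero_smul, sub_zero]

/-- **`R_v ∈ U(2,1)`**: `R_v^* J R_v = J` (when `v^* J v ≠ 0`). -/
theorem jReflection_isUnitary {v : Fin 3 → ℂ} (hv : star v ⬝ᵥ (J *ᵥ v) ≠ 0) :
    IsUnitaryOf (starRingAut : ℂ ≃+* ℂ) J (jReflection v) := by
  set q := star v ⬝ᵥ (J *ᵥ v) with hqdef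
  have hq : star q = q := by rw [Complex.star_def]; exact conj_jform_self v
  have hq2 : star (2 / q) = 2 / q := by
    rw [Complex.star_def, map_div₀, map_ofNat, ← Complex.star_def, hq]
  have hqv : star (J *ᵥ v) ⬝ᵥ v = q := star_J_mulVec_dotProduct v v
  have hcoef : (2 / q) * (2 / q) * q = 2 / q + 2 / q := by field_simp; ring
  have hRH : (jReflection v)ᴴ = 1 - (2 / q) • vecMulVec (J *ᵥ v) (star v) := by
    unfold jReflection
    rw [← hqdef, Matrix.conjTranspose_sub, Matrix.conjTranspose_one, Matrix.conjTranspose_smul,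
      conjTranspose_vecMulVec, star_star, hq2]
  have hJP : J * vecMulVec v (star (J *ᵥ v)) = vecMulVec (J *ᵥ v) (star (J *ᵥ v)) := mul_vecMulVec _ _ _
  have hP'J : vecMulVec (J *ᵥ v) (star v) * J = vecMulVec (J *ᵥ v) (star (J *ᵥ v)) := by
    rw [vecMulVec_mul, star_J_mulVec]
  have hQP : vecMulVec (J *ᵥ v) (star (J *ᵥ v)) * vecMulVec v (star (J *ᵥ v)) =
      q • vecMulVec (J *ᵥ v) (star (J *ᵥ v)) := by
    rw [vecMulVec_mul_vecMulVec, hqv, vecMulVec_smul]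
  unfold IsUnitaryOf
  rw [cstar_starRingAut_eq, hRH]
  unfold jReflection
  rw [← hqdef, Matrix.sub_mul, Matrix.one_mul, Matrix.smul_mul, hP'J, Matrix.sub_mul, Matrix.mul_sub,
    Matrix.mul_sub, Matrix.mul_one, Matrix.mul_one, Matrix.mul_smul, hJP, Matrix.smul_mul, Matrix.mul_smul, hQP,
    smul_smul, smul_smul, hcoef, add_smul]
  abel

/-! ## 3. The reflection at `v = lift3 z` fixes `z` with Jacobian `−1` -/

/-- `lift3 z` at `castSucc k` is `z k`. -/
theorem lift3_castSucc (z : Fin 2 → ℂ) (k : Fin 2) : lift3 z (Fin.castSucc k) = z k := by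
  fin_cases k <;> rfl

/-- `lift3 z` at `2` is `1`. -/
theorem lift3_two (z : Fin 2 → ℂ) : lift3 z 2 = 1 := rfl

/-- `(J (lift3 z))` at `castSucc l` is `z l`. -/
theorem J_mulVec_lift3_castSucc (z : Fin 2 → ℂ) (l : Fin 2) : (J *ᵥ lift3 z) (Fin.castSucc l) = z l := by
  rw [J_mulVec]
  fin_cases l <;> rfl

/-- The reflection in `(lift3 z)^{⊥_J}` fixes `z`. -/
theorem actM_jReflection_lift3 {z : Fin 2 → ℂ} (hz : z ∈ ball) : actM (jReflection (lift3 z)) z = z := by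
  ext k
  unfold actM
  rw [jReflection_mulVec_self (jform_lift3_self_ne_zero hz)]
  simp [lift3_castSucc, lift3_two]

/-- The derivative of `w ↦ (M (lift3 w)) i`: an affine map with linear part `h ↦ M i 0 h 0 + M i 1 h 1`. -/
theorem hasFDerivAt_mulVec_lift3 (M : Matrix (Fin 3) (Fin 3) ℂ) (i : Fin 3) (w : Fin 2 → ℂ) :
    HasFDerivAt (fun w : Fin 2 → ℂ => (M *ᵥ lift3 w) i)
      (M i 0 • ContinuousLinearMap.proj (R := ℂ) (φ := fun _ : Fin 2 => ℂ) 0 +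
        M i 1 • ContinuousLinearMap.proj (R := ℂ) (φ := fun _ : Fin 2 => ℂ) 1) w := by
  have hfun : (fun w : Fin 2 → ℂ => (M *ᵥ lift3 w) i) = fun w => M i 0 * w 0 + M i 1 * w 1 + M i 2 := by
    funext w
    simp [Matrix.mulVec, dotProduct, Fin.sum_univ_three, lift3]
  rw [hfun]
  exact (((hasFDerivAt_apply (𝕜 := ℂ) 0 w).const_mul (M i 0)).add
    ((hasFDerivAt_apply (𝕜 := ℂ) 1 w).const_mul (M i 1))).add_const (M i 2)

/-- The linear part evaluated on the `l`-th basis vector is the entry `M i l`. -/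
theorem affine_apply_single (M : Matrix (Fin 3) (Fin 3) ℂ) (i : Fin 3) (l : Fin 2) :
    (M i 0 • ContinuousLinearMap.proj (R := ℂ) (φ := fun _ : Fin 2 => ℂ) 0 +
      M i 1 • ContinuousLinearMap.proj (R := ℂ) (φ := fun _ : Fin 2 => ℂ) 1) (Pi.single l 1) =
      M i (Fin.castSucc l) := by
  fin_cases l <;> simp

/-- **THE JACOBIAN OF THE FRACTIONAL-LINEAR ACTION** at a point where the denominator does not vanish:
`∂_l (M z)_k = d⁻¹ M_{kl} − N_k d⁻² M_{2l}` with `N = M (lift3 z)`, `d = N_2`. -/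
theorem pd_actM_eq (M : Matrix (Fin 3) (Fin 3) ℂ) {z : Fin 2 → ℂ} (hd : (M *ᵥ lift3 z) 2 ≠ 0) (k l : Fin 2) :
    pd l (fun w => actM M w k) z =
      ((M *ᵥ lift3 z) 2)⁻¹ * M (Fin.castSucc k) (Fin.castSucc l) -
        (M *ᵥ lift3 z) (Fin.castSucc k) * ((M *ᵥ lift3 z) 2 ^ 2)⁻¹ * M 2 (Fin.castSucc l) := by
  have hc := hasFDerivAt_mulVec_lift3 M (Fin.castSucc k) z
  have hdd := hasFDerivAt_mulVec_lift3 M 2 z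
  have hinv := (hasFDerivAt_inv hd).comp z hdd
  have hmul : HasFDerivAt (fun w => (M *ᵥ lift3 w) (Fin.castSucc k) * ((M *ᵥ lift3 w) 2)⁻¹)
      ((M *ᵥ lift3 z) (Fin.castSucc k) •
          ((ContinuousLinearMap.toSpanSingleton ℂ (-((M *ᵥ lift3 z) 2 ^ 2)⁻¹)).comp
            (M 2 0 • ContinuousLinearMap.proj (R := ℂ) (φ := fun _ : Fin 2 => ℂ) 0 +
              M 2 1 • ContinuousLinearMap.proj (R := ℂ) (φ := fun _ : Fin 2 => ℂ) 1)) +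
        ((M *ᵥ lift3 z) 2)⁻¹ •
          (M (Fin.castSucc k) 0 • ContinuousLinearMap.proj (R := ℂ) (φ := fun _ : Fin 2 => ℂ) 0 +
            M (Fin.castSucc k) 1 • ContinuousLinearMap.proj (R := ℂ) (φ := fun _ : Fin 2 => ℂ) 1)) z :=
    hc.mul hinv
  have hfun : (fun w => actM M w k) = fun w => (M *ᵥ lift3 w) (Fin.castSucc k) * ((M *ᵥ lift3 w) 2)⁻¹ := by
    funext w
    simp [actM, div_eq_mul_inv]
  unfold pd
  rw [hfun, hmul.fderiv, _root_.add_apply, _root_.smul_apply, _root_.smul_apply, ContinuousLinearMap.comp_apply,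
    affine_apply_single, affine_apply_single, ContinuousLinearMap.toSpanSingleton_apply, smul_eq_mul, smul_eq_mul,
    smul_eq_mul]
  ring

/-- The Jacobian of the reflection in `(lift3 z)^{⊥_J}` at `z` is `−1`. -/
theorem pd_actM_jReflection {z : Fin 2 → ℂ} (hz : z ∈ ball) (k l : Fin 2) :
    pd l (fun w => actM (jReflection (lift3 z)) w k) z = -(if k = l then 1 else 0) := by
  have hv := jform_lift3_self_ne_zero hz
  have hR : jReflection (lift3 z) *ᵥ lift3 z = -lift3 z := jReflection_mulVec_self hv
  have hd : (jReflection (lift3 z) *ᵥ lift3 z) 2 ≠ 0 := by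
    rw [hR, Pi.neg_apply, lift3_two]
    exact neg_ne_zero.2 one_ne_zero
  rw [pd_actM_eq _ hd, hR]
  simp only [Pi.neg_apply, lift3_castSucc, lift3_two, jReflection_apply, J_mulVec_lift3_castSucc,
    Fin.castSucc_inj]
  have h2 : (2 : Fin 3) ≠ Fin.castSucc l := by fin_cases l <;> decide
  rw [if_neg h2]
  ring

/-! ## 4. Every equivariant datum vanishes on the `J`-orthogonal locus -/

/-- **VANISHING ON THE `J`-ORTHOGONAL LOCUS.** For a datum with the `U(2,1)`-equivariance of `ThetaData.equiv`,
`Φ(y, z) = 0` whenever `z ∈ 𝔹` and `(lift3 z)^* J y = 0`: the reflection `R` in `(lift3 z)^{⊥_J}` is in `U(2,1)`, fixes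
`z` and `y`, and has Jacobian `−1` at `z`, so the `(1,0)`-form `Φ(y, ·)` at `z` equals its own negative. -/
theorem datumS_eq_zero_of_jOrth (Φ : KMDatumS)
    (hequiv : ∀ M : Matrix (Fin 3) (Fin 3) ℂ, IsUnitaryOf (starRingAut : ℂ ≃+* ℂ) J M →
      ∀ (y : Fin 3 → ℂ) (z : Fin 2 → ℂ), z ∈ ball → ∀ l,
        (∑ k : Fin 2, datumS Φ (M *ᵥ y) (actM M z) k * pd l (fun w => actM M w k) z) = datumS Φ y z l)
    {y : Fin 3 → ℂ} {z : Fin 2 → ℂ} (hz : z ∈ ball) (hy : star (lift3 z) ⬝ᵥ (J *ᵥ y) = 0) (l : Fin 2) :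
    datumS Φ y z l = 0 := by
  have h := hequiv _ (jReflection_isUnitary (jform_lift3_self_ne_zero hz)) y z hz l
  rw [jReflection_mulVec_of_jOrth _ hy, actM_jReflection_lift3 hz, Fin.sum_univ_two,
    pd_actM_jReflection hz 0 l, pd_actM_jReflection hz 1 l] at h
  fin_cases l
  · show datumS Φ y z 0 = 0
    simp only [Fin.zero_eta, Fin.isValue, if_true, Fin.one_eq_zero_iff, OfNat.ofNat_ne_one, if_false,
      neg_zero, mul_zero, add_zero, mul_neg, mul_one] at h
    linear_combination (-1 / 2 : ℂ) * h
  · show datumS Φ y z 1 = 0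
    simp only [Fin.mk_one, Fin.isValue, Fin.zero_eq_one_iff, OfNat.ofNat_ne_one, if_false, if_true,
      neg_zero, mul_zero, zero_add, mul_neg, mul_one] at h
    linear_combination (-1 / 2 : ℂ) * h

namespace T4Data

/-- The datum of any `ThetaData` vanishes on the `J`-orthogonal locus. -/
theorem ThetaData.datumS_eq_zero_of_jOrth {X : T4Data} (D : X.ThetaData) {y : Fin 3 → ℂ} {z : Fin 2 → ℂ}
    (hz : z ∈ ball) (hy : star (lift3 z) ⬝ᵥ (J *ᵥ y) = 0) (l : Fin 2) : datumS D.Φ y z l = 0 :=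
  Line3.datumS_eq_zero_of_jOrth D.Φ D.equiv hz hy l

/-- **THE QUADRUPLE KERNEL VANISHES** at every `z ∈ 𝔹` that is `J`-orthogonal to one of the four slots. -/
theorem kernel_eq_zero_of_jOrth (X : T4Data) (D : X.ThetaData) (x : X.Tuple) {z : Fin 2 → ℂ} (hz : z ∈ ball)
    (j : Fin 4) (hj : star (lift3 z) ⬝ᵥ (J *ᵥ X.ballCoord (x j)) = 0) : X.kernel D.Φ x z = 0 := by
  have h0 : ∀ k, datumS D.Φ (X.ballCoord (x j)) z k = 0 := fun k => D.datumS_eq_zero_of_jOrth hz hj k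
  unfold T4Data.kernel wedge
  fin_cases j <;> simp only [Fin.zero_eta, Fin.mk_one, Fin.isValue, Fin.reduceFinMk] at h0 ⊢ <;> simp [h0]

/-- For a `J`-positive vector `y` (`(y^* J y).re > 0`) the `J`-orthogonal line `{z : (lift3 z)^* J y = 0}` meets the ball:
the point `z = (conj y₂ / (|y₀|² + |y₁|²)) · (y₀, y₁)` does (`|z|² = |y₂|²/(|y₀|²+|y₁|²) < 1`). -/
theorem exists_mem_ball_jOrth {y : Fin 3 → ℂ} (hy : 0 < (star y ⬝ᵥ (J *ᵥ y)).re) :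
    ∃ z ∈ ball, star (lift3 z) ⬝ᵥ (J *ᵥ y) = 0 := by
  have hre : (star y ⬝ᵥ (J *ᵥ y)).re = ‖y 0‖ ^ 2 + ‖y 1‖ ^ 2 - ‖y 2‖ ^ 2 := by
    rw [jform_eq]
    simp only [Complex.sub_re, Complex.add_re, Complex.mul_re, Complex.conj_re, Complex.conj_im, Complex.sq_norm,
      Complex.normSq_apply]
    ring
  rw [hre] at hy
  have hspos : 0 < ‖y 0‖ ^ 2 + ‖y 1‖ ^ 2 := by nlinarith [sq_nonneg ‖y 2‖]
  have hs0 : ((‖y 0‖ ^ 2 + ‖y 1‖ ^ 2 : ℝ) : ℂ) ≠ 0 := by exact_mod_cast hspos.ne'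
  refine ⟨fun i => (conj (y 2) / ((‖y 0‖ ^ 2 + ‖y 1‖ ^ 2 : ℝ) : ℂ)) * y (Fin.castSucc i), ?_, ?_⟩
  · show nsq _ < 1
    have hn : nsq (fun i => (conj (y 2) / ((‖y 0‖ ^ 2 + ‖y 1‖ ^ 2 : ℝ) : ℂ)) * y (Fin.castSucc i)) =
        ‖y 2‖ ^ 2 / (‖y 0‖ ^ 2 + ‖y 1‖ ^ 2) := by
      unfold nsq
      simp only [norm_mul, norm_div, Complex.norm_real, Real.norm_eq_abs, abs_of_pos hspos, Complex.norm_conj,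
        Fin.castSucc_zero, Fin.castSucc_one, mul_pow, div_pow]
      field_simp
    rw [hn, div_lt_one hspos]
    linarith
  · rw [jform_eq]
    simp only [lift3, Matrix.cons_val_zero, Matrix.cons_val_one, Matrix.head_cons, Matrix.cons_val_two,
      Matrix.tail_cons, map_one, one_mul, map_mul, map_div₀, Complex.conj_conj, Complex.conj_ofReal,
      Fin.castSucc_zero, Fin.castSucc_one]
    have h0 : conj (y 0) * y 0 = ((‖y 0‖ ^ 2 : ℝ) : ℂ) := by rw [Complex.conj_mul']; push_cast; ring
    have h1 : conj (y 1) * y 1 = ((‖y 1‖ ^ 2 : ℝ) : ℂ) := by rw [Complex.conj_mul']; push_cast; ring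
    have key : y 2 / ((‖y 0‖ ^ 2 + ‖y 1‖ ^ 2 : ℝ) : ℂ) * (conj (y 0) * y 0 + conj (y 1) * y 1) = y 2 := by
      rw [h0, h1]
      push_cast
      rw [div_mul_cancel₀ _ (by push_cast at hs0; exact hs0)]
    linear_combination key

end T4Data

end Summit.Ventures.HodgeRepro.Tier4.Line3

end
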